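import Literature.Topology.FourManifolds.SurfaceGroupCutKernelMoves
import HarnessLib

/-!
# The Goeritz group of a family of cut systems contains the elementary symplectic moves
# compatible with the cuts

Topic `Literature/Topology/FourManifolds`; theorems only, sequel to `SurfaceGroupCutKernelMoves.lean`
(the two-handle move of type (C) of `SurfaceGroupCutKernelMovesZ.lean` and the orientation flip of
`SurfaceGroupOrientationFlip.lean` enter as the hypotheses `hZgt`, `hFlip`, stated exactly as
proved there, so that this file does not depend on them).  For a family `𝒞` of cut
systems of `S_g` (each `c ∈ 𝒞` picks one letter per handle) the GOERITZ GROUP of `𝒞` is the group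
of automorphisms of `S_g` stabilising every cut kernel `cutKernel c`, `c ∈ 𝒞` (for the two cut
systems of a Heegaard splitting this is the group of the splitting, Goeritz 1933 for `S³`; for
one cut system it is the handlebody group, Griffiths 1964).  Its image in `GL(H₁) = GL_{2g}(ℤ)` —
the `ℤ`-linear automorphisms `F` REALISED (`ab ∘ x = F ∘ ab`) by some `x` of the Goeritz group —
is a subgroup (`SurfaceGroup.exists_goeritzSubgroup`; below `R` with its defining property `hR`),
and this file lists elements of it, each with the exact compatibility condition on the cuts:

* `signFlip_mem_goeritz` (the sign change of a handle, every `𝒞`), `orientationFlip_mem_goeritz`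
  (the anti-symplectic involution `δ_{aᵢ} ↦ -δ_{aᵢ}`, every `𝒞`);
* `moveX_mem_goeritz` — `moveX j n : δ_{bⱼ} ↦ δ_{bⱼ} + n δ_{aⱼ}` if every `c ∈ 𝒞` cuts `aⱼ`;
* `moveZ_mem_goeritz` — `moveZ i j n : δ_{aⱼ} ↦ δ_{aⱼ} + n δ_{aᵢ}, δ_{bᵢ} ↦ δ_{bᵢ} - n δ_{bⱼ}` if
  every `c ∈ 𝒞` has `c i = false ∨ c j = true` (for `j < i` this is ZVC's move (C) of
  `SurfaceGroupCutKernelMovesZ.lean`, hypothesis `hZgt`; for `i < j` its conjugate by the cut swap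
  of all handles,
  through the identity `J Z_{ji}(1)⁻¹ J⁻¹ = Z_{ij}(1)` on `H₁`, `swapLin_mul_moveZ_inv`);
* `moveW_mem_goeritz` — `moveW i j n : δ_{bᵢ} ↦ δ_{bᵢ} + n δ_{aⱼ}, δ_{bⱼ} ↦ δ_{bⱼ} + n δ_{aᵢ}` if
  every `c ∈ 𝒞` has `c i = false ∨ c j = false` (the conjugate of `Z_{ij}(1)⁻¹` by the cut swap
  of handle `j`, through `J_j⁻¹ Z_{ij}(1)⁻¹ J_j = W_{ij}(1)`, `moveZ_inv_mul_swapAt`).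

Integer parameters come from parameter `1` by `shear_mem`.  Consumed by the realisation of the
stabiliser of two coordinate Lagrangians (the Goeritz group of the standard Heegaard splitting of
`#ᵏ S¹×S²` maps onto it).

## References

* H. Zieschang, E. Vogt, H.-D. Coldewey, *Surfaces and Planar Discontinuous Groups*, LNM 835
  (1980), §3.6 (3.6.7, 3.6.9). [ZieschangVogtColdewey1980]
* H. B. Griffiths, *Automorphisms of a 3-dimensional handlebody*, Abh. Math. Sem. Univ. Hamburg 26
  (1964) 191–210. [GriffithsHB1964Handlebody]
-/

noncomputable section

namespace Literature.Topology.FourManifolds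

open Multiplicative Subgroup

/-! ## Two identities between elementary moves and quarter rotations on `H₁` -/

section Identities

variable {ι : Type*} [DecidableEq ι]

/-- `Z_{ij}(c)⁻¹ = Z_{ij}(-c)`. [folklore] -/
theorem moveZ_inv {i j : ι} (h : i ≠ j) (c : ℤ) :
    (moveZ i j h c : (ι × Bool → ℤ) ≃ₗ[ℤ] (ι × Bool → ℤ))⁻¹ = moveZ i j h (-c) := by
  refine inv_eq_of_mul_eq_one_right ?_
  change shear (nilZ i j) (nilZ_nilZ h) c * shear (nilZ i j) (nilZ_nilZ h) (-c) = 1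
  rw [← shear_add, add_neg_cancel, shear_zero]

/-- **Conjugating the move of type (C) by the quarter rotation of all handles transposes it**:
if `(J v)_{bₚ} = v_{aₚ}`, `(J v)_{aₚ} = -v_{bₚ}` for all handles `p`, then
`J · Z_{lk}(1)⁻¹ = Z_{kl}(1) · J`. [folklore] -/
theorem swapLin_mul_moveZ_inv {k l : ι} (hkl : k ≠ l) (J : (ι × Bool → ℤ) ≃ₗ[ℤ] (ι × Bool → ℤ))
    (hJ : ∀ v p, J v p = if p.2 then v (p.1, false) else -v (p.1, true)) :
    J * (moveZ l k hkl.symm 1)⁻¹ = moveZ k l hkl 1 * J := by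
  rw [moveZ_inv]
  refine LinearEquiv.ext fun v => funext fun p => ?_
  obtain ⟨q, s⟩ := p
  simp only [linearEquiv_mul_apply]
  rw [hJ, moveZ_apply]
  cases s
  · simp only [Bool.false_eq_true, if_false, Pi.add_apply, Pi.smul_apply, Pi.sub_apply, smul_eq_mul,
      hJ, if_true, moveZ_apply, Pi.single_apply, Prod.mk.injEq, Bool.true_eq_false, and_false,
      if_false, and_true, Bool.false_eq_true]
    split_ifs <;> ring
  · simp only [if_true, Pi.add_apply, Pi.smul_apply, Pi.sub_apply, smul_eq_mul, hJ, moveZ_apply,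
      Pi.single_apply, Prod.mk.injEq, Bool.true_eq_false, and_false, if_false, and_true,
      Bool.false_eq_true]
    split_ifs <;> ring

/-- **Conjugating the inverse move of type (C) by the quarter rotation of the second handle gives
the symmetric shear**: if `(J v)_{bⱼ} = v_{aⱼ}`, `(J v)_{aⱼ} = -v_{bⱼ}` on handle `j` and `J` is the
identity on the other handles, then `Z_{ij}(1)⁻¹ · J = J · W_{ij}(1)`. [folklore] -/
theorem moveZ_inv_mul_swapAt {i j : ι} (h : i ≠ j) (J : (ι × Bool → ℤ) ≃ₗ[ℤ] (ι × Bool → ℤ))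
    (hJ : ∀ v p, J v p = if p.1 = j then (if p.2 then v (p.1, false) else -v (p.1, true)) else v p) :
    (moveZ i j h 1)⁻¹ * J = J * moveW i j 1 := by
  rw [moveZ_inv]
  refine LinearEquiv.ext fun v => funext fun p => ?_
  obtain ⟨q, s⟩ := p
  simp only [linearEquiv_mul_apply]
  rw [moveZ_apply, hJ]
  by_cases hq : q = j
  · subst hq
    cases s
    · simp only [Bool.false_eq_true, if_false, if_true, Pi.add_apply, Pi.smul_apply, Pi.sub_apply,
        smul_eq_mul, hJ, moveW_apply, Pi.single_apply, Prod.mk.injEq, and_true, and_false, h.symm,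
        Bool.true_eq_false]
      ring
    · simp only [if_true, Pi.add_apply, Pi.smul_apply, Pi.sub_apply, smul_eq_mul, hJ, moveW_apply,
        Pi.single_apply, Prod.mk.injEq, and_true, and_false, h.symm, Bool.true_eq_false,
        Bool.false_eq_true, if_false, h]
      ring
  · cases s
    · simp only [hq, if_false, Pi.add_apply, Pi.smul_apply, Pi.sub_apply, smul_eq_mul, hJ, moveW_apply,
        Pi.single_apply, Prod.mk.injEq, and_true, and_false, Bool.true_eq_false, Bool.false_eq_true,
        if_true]
      split_ifs <;> ring
    · simp only [hq, if_false, Pi.add_apply, Pi.smul_apply, Pi.sub_apply, smul_eq_mul, hJ, moveW_apply,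
        Pi.single_apply, Prod.mk.injEq, and_true, and_false, Bool.true_eq_false, Bool.false_eq_true,
        if_true]
      ring

end Identities

namespace SurfaceGroup

variable {g : ℕ}

/-! ## The image of the Goeritz group of a family of cut systems in `GL(H₁)` -/

/-- Bookkeeping: the image of a subgroup under a composite of automorphisms. [folklore] -/
theorem map_trans_toMonoidHom {G : Type*} [Group G] (x y : G ≃* G) (K : Subgroup G) :
    K.map (x.trans y).toMonoidHom = (K.map x.toMonoidHom).map y.toMonoidHom := by
  rw [Subgroup.map_map]
  rfl

/-- Bookkeeping: if `x` carries `K` onto `K'` then `x⁻¹` carries `K'` onto `K`. [folklore] -/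
theorem map_symm_toMonoidHom_of_eq {G : Type*} [Group G] (x : G ≃* G) {K K' : Subgroup G}
    (h : K.map x.toMonoidHom = K') : K'.map x.symm.toMonoidHom = K := by
  rw [← h, Subgroup.map_map]
  have : x.symm.toMonoidHom.comp x.toMonoidHom = MonoidHom.id G := MonoidHom.ext fun s => by simp
  rw [this, Subgroup.map_id]

/-- **The image of the Goeritz group in `GL(H₁)` is a subgroup**: the `ℤ`-linear automorphisms of
`H₁ = ℤ^{2g}` realised by automorphisms of `S_g` stabilising every cut kernel of the family `𝒞`
form a subgroup `R` (identity, composites, inverses of realisers). [folklore] -/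
theorem exists_goeritzSubgroup (𝒞 : Set (Fin g → Bool)) :
    ∃ R : Subgroup ((surfaceGen g → ℤ) ≃ₗ[ℤ] (surfaceGen g → ℤ)),
      ∀ F, F ∈ R ↔ ∃ x : SurfaceGroup g ≃* SurfaceGroup g,
        (∀ c ∈ 𝒞, (cutKernel c).map x.toMonoidHom = cutKernel c) ∧
        ∀ s, toAdd (SurfaceGroup.abelianize g (x s)) = F (toAdd (SurfaceGroup.abelianize g s)) := by
  let P : ((surfaceGen g → ℤ) ≃ₗ[ℤ] (surfaceGen g → ℤ)) → Prop := fun F =>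
    ∃ x : SurfaceGroup g ≃* SurfaceGroup g,
      (∀ c ∈ 𝒞, (cutKernel c).map x.toMonoidHom = cutKernel c) ∧
      ∀ s, toAdd (SurfaceGroup.abelianize g (x s)) = F (toAdd (SurfaceGroup.abelianize g s))
  refine ⟨{ carrier := setOf P, one_mem' := ?_, mul_mem' := ?_, inv_mem' := ?_ }, fun F => Iff.rfl⟩
  · rintro F F' ⟨x, hx, hxF⟩ ⟨y, hy, hyF⟩
    exact ⟨y.trans x, fun c hc => by rw [map_trans_toMonoidHom, hy c hc, hx c hc], realises_mul hxF hyF⟩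
  · refine ⟨MulEquiv.refl _, fun c _ => ?_, fun s => rfl⟩
    have : (MulEquiv.refl (SurfaceGroup g)).toMonoidHom = MonoidHom.id _ := rfl
    rw [this, Subgroup.map_id]
  · rintro F ⟨x, hx, hxF⟩
    exact ⟨x.symm, fun c hc => map_symm_toMonoidHom_of_eq x (hx c hc), realises_inv hxF⟩

section Generators

variable (𝒞 : Set (Fin g → Bool)) (R : Subgroup ((surfaceGen g → ℤ) ≃ₗ[ℤ] (surfaceGen g → ℤ)))
  (hR : ∀ F, F ∈ R ↔ ∃ x : SurfaceGroup g ≃* SurfaceGroup g,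
    (∀ c ∈ 𝒞, (cutKernel c).map x.toMonoidHom = cutKernel c) ∧
    ∀ s, toAdd (SurfaceGroup.abelianize g (x s)) = F (toAdd (SurfaceGroup.abelianize g s)))
include hR

/-- The sign change of handle `j` lies in the image of every Goeritz group. [folklore] -/
theorem signFlip_mem_goeritz (j : Fin g) :
    ∃ E ∈ R, ∀ v p, E v p = (if p.1 = j then -1 else 1) * v p := by
  obtain ⟨x, E, hE, hx, hxE⟩ := exists_realises_signFlip j
  exact ⟨E, (hR E).2 ⟨x, fun c _ => hx c, hxE⟩, hE⟩

/-- The anti-symplectic involution `δ_{aᵢ} ↦ -δ_{aᵢ}`, `δ_{bᵢ} ↦ δ_{bᵢ}` lies in the image of every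
Goeritz group (orientation reversal). [folklore] -/
theorem orientationFlip_mem_goeritz
    (hFlip : ∃ (x : SurfaceGroup g ≃* SurfaceGroup g) (Θ : (surfaceGen g → ℤ) ≃ₗ[ℤ] (surfaceGen g → ℤ)),
      (∀ v p, Θ v p = (if p.2 then 1 else -1) * v p) ∧
      (∀ c : Fin g → Bool, (cutKernel c).map x.toMonoidHom = cutKernel c) ∧
      ∀ s, toAdd (SurfaceGroup.abelianize g (x s)) = Θ (toAdd (SurfaceGroup.abelianize g s)))
    : ∃ Θ ∈ R, ∀ v p, Θ v p = (if p.2 then 1 else -1) * v p := by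
  obtain ⟨x, Θ, hΘ, hx, hxΘ⟩ := hFlip
  exact ⟨Θ, (hR Θ).2 ⟨x, fun c _ => hx c, hxΘ⟩, hΘ⟩

/-- `moveX j n` lies in the image of the Goeritz group of `𝒞` if every cut of `𝒞` cuts `aⱼ`.
[cite: ZieschangVogtColdewey1980, 3.6.9 (A)] -/
theorem moveX_mem_goeritz (j : Fin g) (hj : ∀ c ∈ 𝒞, c j = false) (n : ℤ) : moveX j n ∈ R := by
  refine shear_mem _ _ R ((hR _).2 ?_) n
  obtain ⟨x, hx, hxF⟩ := exists_realises_moveX_cut j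
  exact ⟨x, fun c hc => hx c (hj c hc), hxF⟩

/-- **`moveZ i j n` lies in the image of the Goeritz group of `𝒞` if no cut of `𝒞` cuts `bᵢ` and
`aⱼ`** (`c i = false ∨ c j = true` for all `c ∈ 𝒞`).  For `j < i` this is the move of type (C)
of `SurfaceGroupCutKernelMovesZ.lean`; for `i < j` it is the conjugate of the inverse of the move
`Z_{ji}` by the cut swap of all handles, which flips every cut. [cite: ZieschangVogtColdewey1980, 3.6.9 (C)] -/
theorem moveZ_mem_goeritz
    (hZgt : ∀ (k l : Fin g) (hkl : k < l), ∃ x : SurfaceGroup g ≃* SurfaceGroup g,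
      (∀ c : Fin g → Bool, (c l = false ∨ c k = true) →
        (cutKernel c).map x.toMonoidHom = cutKernel c) ∧
      ∀ s, toAdd (SurfaceGroup.abelianize g (x s)) =
        moveZ l k hkl.ne' 1 (toAdd (SurfaceGroup.abelianize g s)))
    (i j : Fin g) (h : i ≠ j) (hij : ∀ c ∈ 𝒞, c i = false ∨ c j = true)
    (n : ℤ) : moveZ i j h n ∈ R := by
  refine shear_mem _ _ R ((hR _).2 ?_) n
  change ∃ x : SurfaceGroup g ≃* SurfaceGroup g, _ ∧
    ∀ s, toAdd (SurfaceGroup.abelianize g (x s)) = moveZ i j h 1 (toAdd (SurfaceGroup.abelianize g s))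
  rcases lt_or_gt_of_ne h with hlt | hgt
  · -- `i < j`: conjugate `Z_{ji}(1)⁻¹` by the cut swap of all handles
    obtain ⟨z, hz, hzF⟩ := hZgt i j hlt
    obtain ⟨J, hJ, hκ⟩ := exists_realises_cutSwapEquiv (g := g) (fun _ => true)
    have hJ' : ∀ v p, J v p = if p.2 then v (p.1, false) else -v (p.1, true) := fun v p => by
      rw [hJ, if_pos rfl]
    refine ⟨((cutSwapEquiv fun _ => true).symm.trans z.symm).trans (cutSwapEquiv fun _ => true),
      fun c hc => ?_, fun s => ?_⟩
    · have hflip : (cutKernel fun p => !c p).map (cutSwapEquiv (g := g) fun _ => true).toMonoidHom =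
          cutKernel c := by
        rw [map_cutKernel_cutSwapEquiv]
        simp
      rw [map_trans_toMonoidHom, map_trans_toMonoidHom, map_symm_toMonoidHom_of_eq _ hflip,
        map_symm_toMonoidHom_of_eq _ (hz _ ?_), hflip]
      rcases hij c hc with h' | h'
      · exact Or.inr (by simp [h'])
      · exact Or.inl (by simp [h'])
    · rw [realises_mul hκ (realises_mul (realises_inv hzF) (realises_inv hκ)) s, ← mul_assoc,
        swapLin_mul_moveZ_inv h J hJ', mul_assoc, mul_inv_cancel, mul_one]
  · obtain ⟨z, hz, hzF⟩ := hZgt j i hgt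
    exact ⟨z, fun c hc => hz c (hij c hc), hzF⟩

omit hR in
/-- Flipping the cut of handle `j` in every member of a family. [folklore] -/
theorem mem_image_flipAt (j : Fin g) (c : Fin g → Bool) (hc : c ∈ 𝒞) :
    (fun p => if p = j then !c p else c p) ∈ (fun c' : Fin g → Bool => fun p => if p = j then !c' p else c' p) '' 𝒞 :=
  ⟨c, hc, rfl⟩

/-- **`moveW i j n` lies in the image of the Goeritz group of `𝒞` if no cut of `𝒞` cuts `bᵢ` and
`bⱼ`** (`c i = false ∨ c j = false` for all `c ∈ 𝒞`): it is the conjugate of `Z_{ij}(1)⁻¹` by the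
cut swap of handle `j`, which realises `Z_{ij}(1)` against the family of cuts flipped at `j`.
[folklore] -/
theorem moveW_mem_goeritz
    (hZgt : ∀ (k l : Fin g) (hkl : k < l), ∃ x : SurfaceGroup g ≃* SurfaceGroup g,
      (∀ c : Fin g → Bool, (c l = false ∨ c k = true) →
        (cutKernel c).map x.toMonoidHom = cutKernel c) ∧
      ∀ s, toAdd (SurfaceGroup.abelianize g (x s)) =
        moveZ l k hkl.ne' 1 (toAdd (SurfaceGroup.abelianize g s)))
    (i j : Fin g) (h : i ≠ j) (hij : ∀ c ∈ 𝒞, c i = false ∨ c j = false)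
    (n : ℤ) : moveW i j n ∈ R := by
  refine shear_mem _ _ R ((hR _).2 ?_) n
  change ∃ x : SurfaceGroup g ≃* SurfaceGroup g, _ ∧
    ∀ s, toAdd (SurfaceGroup.abelianize g (x s)) = moveW i j 1 (toAdd (SurfaceGroup.abelianize g s))
  -- the family flipped at `j`, its Goeritz image, and a realiser of `Z_{ij}(1)` in it
  set 𝒞' : Set (Fin g → Bool) := (fun c' : Fin g → Bool => fun p => if p = j then !c' p else c' p) '' 𝒞
    with h𝒞'
  obtain ⟨R', hR'⟩ := exists_goeritzSubgroup 𝒞'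
  have hmem : moveZ i j h 1 ∈ R' := by
    refine moveZ_mem_goeritz 𝒞' R' hR' hZgt i j h ?_ 1
    rintro _ ⟨c, hc, rfl⟩
    rcases hij c hc with h' | h'
    · exact Or.inl (by simp [h, h'])
    · exact Or.inr (by simp [h'])
  obtain ⟨z, hz, hzF⟩ := (hR' _).1 hmem
  obtain ⟨J, hJ, hκ⟩ := exists_realises_cutSwapEquiv (g := g) (fun p => decide (p = j))
  have hJ' : ∀ v p, J v p = if p.1 = j then (if p.2 then v (p.1, false) else -v (p.1, true)) else v p :=
    fun v p => by rw [hJ]; simp only [decide_eq_true_eq]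
  refine ⟨((cutSwapEquiv fun p => decide (p = j)).trans z.symm).trans
      (cutSwapEquiv fun p => decide (p = j)).symm, fun c hc => ?_, fun s => ?_⟩
  · have hflip : (cutKernel c).map (cutSwapEquiv (g := g) fun p => decide (p = j)).toMonoidHom =
        cutKernel (fun p => if p = j then !c p else c p) := by
      rw [map_cutKernel_cutSwapEquiv]
      congr 1
      funext p
      by_cases hp : p = j <;> simp [hp]
    rw [map_trans_toMonoidHom, map_trans_toMonoidHom, hflip,
      map_symm_toMonoidHom_of_eq _ (hz _ (mem_image_flipAt 𝒞 j c hc)), map_symm_toMonoidHom_of_eq _ hflip]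
  · rw [realises_mul (realises_inv hκ) (realises_mul (realises_inv hzF) hκ) s,
      moveZ_inv_mul_swapAt h J hJ', inv_mul_cancel_left]

end Generators

end SurfaceGroup

end Literature.Topology.FourManifolds

end
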